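import Literature.NumberTheory.Automorphic.OrbitalEulerProductModel
import Literature.MeasureTheory.Group.InvariantQuotientTransport
import Literature.NumberTheory.Automorphic.LocalUnitaryIntegralLevel
import Literature.NumberTheory.Automorphic.LocalUnitaryGroupCongrMeasure
import HarnessLib

/-!
# The split-place dictionary for orbital integrals: `Φ^{U(J)(F_v)}(γ, f) = Φ^{GL_N(E_w)}(γ_w, f ∘ e⁻¹)` along
# `e : U(J)(F_v) ≃ₜ* GL_N(E_w)`
(Rogawski (1990), §4.9 p. 54, §4.1 p. 40 «if `v` splits in `E`, `G_v ≅ GL₃(E_w)`»; Mok (2015), §1 «for `v` split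
`U(N)(F_v) ≅ GL_N(E_w)`»; Gelbart (1975), (9.13); Deitmar–Echterhoff (2014), Thm. 1.5.3)

Topic `NumberTheory/Automorphic`; namespace `Literature.NumberTheory.Automorphic` (§1, generic) and `….UnitaryGroup` (§2).
THEOREMS ONLY (no definition, no instance, no named fact, no `sorry`). Cell `pub/hodgecm-mathlib`, programme P3a, road
(κ-loc-split) under row #88 (LEAD T6-79 «D-S1d»): the GL-side geometric descent (★ `GLnBlockScalarOrbitalIntegral`, ★
`GLnTwoBlockUnipotentHaarTransport`, ★ `Rogawski1990/ArchExplicitTransferFactor*`) is written for `GL (Fin n) F`, while the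
letters speak of `H = U(2) × U(1)`, `G = U(3)` at a place `v` of `F` SPLIT in `E`; this file is the junction «orbital integrals on
`U(J)(F_v)` at a split place ARE orbital integrals on `GL_N(E_w)`» — no constant, no integrability hypothesis.

§1 GENERIC (bicontinuous `e : G ≃* G'`, `e γ = γ'`; the tree had the exact transport only at the `descConj` level — ★
`integral_descConj_map_cosetCongr`, ★ `map_cosetCongr_quotientMeasure` — and at the NAMED level `orbitalIntegral γ f m` only the
`∃ c ≠ 0` forms of ★ `LocalOrbitalIntegralTransport`): `orbitalIntegral_map_cosetCongr` (`O_{γ'}(F; (cosetCongr e)_* μ) = O_γ(F ∘ e; μ)`,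
ANY `μ`), `orbitalIntegral_quotientMeasure_eq_of_mulEquiv` (canonical quotient measures,
`ν' = e_* ν`, `ρ' = (e|_{C(γ)})_* ρ`: `O_{γ'}(F; ν'/ρ') = O_γ(F ∘ e; ν/ρ)`, the conjugator-free `q = 1` reading of ★
`integral_descConj_quotientMeasure_eq_of_conj_apply_eq`).
§2 THE SPLIT PLACE (`E/F` quadratic, `c ≠ 1`, `J` `c`-hermitian, `w ∣ v`, `c • w ≠ w`, `J_w` invertible; `e = localSplitEquiv c J hc hJ w hw hJw`,
★ `UnitaryGroupSplitPlace`): `charpoly_localSplitEquiv` (recognising `e γ`); (d2) `orbitalIntegral_localSplitEquiv_map`,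
`orbitalIntegral_eq_orbitalIntegral_localSplitEquiv`; (d3) at good reduction `J_w ∈ GL_N(𝒪_w)`: `indicator_glInt_comp_localSplitEquiv`
(`1_{GL_N(𝒪_w)} ∘ e = 1_{U(J)(𝒪_v)}`, ★ `mem_localIntegralLevel_iff_of_ne`), `orbitalIntegral_indicator_glInt_localSplitEquiv_map`; (d4)
`measurePreserving_localSplitEquiv` ∕ `map_localSplitEquiv_eq` (`vol U(J)(𝒪_v) = 1 ↦ vol GL_N(𝒪_w) = 1`, ★ `measurePreserving_of_forall_mem_iff`),
`map_subgroupCongrHomeomorph_localSplitEquiv_apply` (centralisers: the mass of `C(γ) ∩ K_v` is that of `C(e γ) ∩ GL_N(𝒪_w)`),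
`map_cosetCongr_localSplitEquiv_quotientMeasure` (`(cosetCongr e)_* (ν/ρ) = ν'/ρ'`), `orbitalIntegral_localSplitEquiv_quotientMeasure`,
`orbitalIntegral_indicator_glInt_localSplitEquiv_quotientMeasure` (`Φ^{GL_N}(e γ, 1_{GL_N(𝒪_w)}) = Φ^{U(J)}(γ, 1_{K_v})`).
CM READING. For a CM field `L` (`F = L⁺`, `E = L`, `c` = complex conjugation) the letters' carriers are `rfl`-abbreviations of the §2
carriers — `(cmDatum L N H).Local v = ↥(«local» L (complexConj L) N H v)` (★ `cmDatum_Local`), `cmLocalIntegralLevel = localIntegralLevel`,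
`localOrbitalIntegral L N H v γ f m = orbitalIntegral γ f m`, `H.map (cmConjRingHom L) = H.map (complexConj L)` (★, `rfl`) — so §2 applies verbatim
at `c := IsCMField.complexConj L`, `hc := complexConj_ne_one L`, `hJw := isUnit_placeForm_of_isUnit_det _ w.1` (pattern of ★ `LocalStableConjSplitPlace`
§2). The GL-side instances `LocallyCompactSpace` ∕ `SecondCountableTopology (GL (Fin N) (E_w))` needed by the canonical quotient measure are
BINDERS, discharged by ★ `UnitaryGroup.locallyCompactSpace_gl_adicCompletion` ∕ ★ `secondCountableTopology_gl_adicCompletion`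
(`UnitaryGroupPureTensorEulerProduct`) or ★ `locallyCompactSpace_generalLinearGroup` (`GLnGelfandKazhdanInvolution`) — not imported, to keep this
closure light. NOT here: `E_w ≅ F_v` at a split `w` (★ `AdicCompletionDegreeOnePlaceProofs`), transfer factors, non-split places.

## References
* J. D. Rogawski, *Automorphic Representations of Unitary Groups in Three Variables* (1990), §4.9 p. 54, §4.1 p. 40, §4.3 p. 44 [Rogawski1990].
* C. P. Mok, *Endoscopic classification of representations of quasi-split unitary groups*, Mem. AMS 235 (2015), §1 p. 5 [Mok2014].
* S. Gelbart, *Automorphic forms on adele groups*, Ann. of Math. Stud. 83 (1975), (9.13) [Gelbart1975].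
* A. Deitmar, S. Echterhoff, *Principles of Harmonic Analysis*, 2nd ed. (2014), Thm. 1.5.3 [DeitmarEchterhoff2014].
* V. Platonov, A. Rapinchuk, *Algebraic Groups and Number Theory* (1994), §5.1 [PlatonovRapinchuk1994].
-/

set_option autoImplicit false

noncomputable section

open MeasureTheory Measure Set Filter Topology NumberField IsDedekindDomain Literature.MeasureTheory.Group
open scoped ENNReal NNReal Matrix MatrixGroups

namespace Literature.NumberTheory.Automorphic

/-! ## §1 Generic: the named orbital integral along `cosetCongr e` -/

section Transport

variable {G G' : Type*} [Group G] [Group G'] [TopologicalSpace G] [TopologicalSpace G']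
  (e : G ≃* G') (he : Continuous e) (hes : Continuous e.symm) {γ : G} {γ' : G'} (hγ : e γ = γ')
  [MeasurableSpace (G ⧸ Subgroup.centralizer ({γ} : Set G))] [BorelSpace (G ⧸ Subgroup.centralizer ({γ} : Set G))]
  [MeasurableSpace (G' ⧸ Subgroup.centralizer ({γ'} : Set G'))]
  [BorelSpace (G' ⧸ Subgroup.centralizer ({γ'} : Set G'))]
  (μ : Measure (G ⧸ Subgroup.centralizer ({γ} : Set G)))

include he hes in
/-- **Exact transport of the named orbital integral along a bicontinuous isomorphism** `e : G ≃* G'`, `e γ = γ'`: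
for EVERY measure `μ` on `G ⧸ C(γ)` and every Banach-valued `F`, `O_{γ'}(F; (cosetCongr e)_* μ) = O_γ(F ∘ e; μ)` — no
constant, no invariance, no integrability hypothesis (★ `integral_descConj_map_cosetCongr`). [cite: Gelbart1975, (9.13)] -/
theorem orbitalIntegral_map_cosetCongr {B : Type*} [NormedAddCommGroup B] [NormedSpace ℝ B] (F : G' → B) :
    orbitalIntegral γ' F (μ.map (cosetCongr e _ _ (forall_apply_mem_centralizer_singleton_iff_of_eq e hγ))) =
      orbitalIntegral γ (F ∘ e) μ := by
  simp only [orbitalIntegral_eq_integral_descConj]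
  exact integral_descConj_map_cosetCongr e he hes hγ μ F

omit [TopologicalSpace G] [TopologicalSpace G'] [MeasurableSpace (G ⧸ Subgroup.centralizer ({γ} : Set G))]
  [BorelSpace (G ⧸ Subgroup.centralizer ({γ} : Set G))] [MeasurableSpace (G' ⧸ Subgroup.centralizer ({γ'} : Set G'))]
  [BorelSpace (G' ⧸ Subgroup.centralizer ({γ'} : Set G'))] in
/-- **Test functions along a level-matching map** `f` (`f a ∈ K' ↔ a ∈ K`): `(1_{K'} · φ) ∘ f = 1_K · (φ ∘ f)`
(Mathlib `Set.indicator_comp_right` with `f ⁻¹' K' = K`). [folklore] -/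
private theorem indicator_comp_eq_of_forall_mem_iff {α β M : Type*} [Zero M] (f : α → β) {K : Set α} {K' : Set β}
    (hK : ∀ a, f a ∈ K' ↔ a ∈ K) (φ : β → M) : K'.indicator φ ∘ f = K.indicator (φ ∘ f) := by
  have hpre : f ⁻¹' K' = K := Set.ext fun a => hK a
  funext a
  rw [Function.comp_apply, ← Set.indicator_comp_right f, hpre]

end Transport

section TransportNormalized

variable {G G' : Type*} [Group G] [Group G'] [TopologicalSpace G] [TopologicalSpace G']
  [IsTopologicalGroup G] [IsTopologicalGroup G'] [LocallyCompactSpace G] [LocallyCompactSpace G']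
  [SecondCountableTopology G] [SecondCountableTopology G'] [T2Space G] [T2Space G']
  [MeasurableSpace G] [BorelSpace G] [MeasurableSpace G'] [BorelSpace G']
  (e : G ≃* G') (he : Continuous e) (hes : Continuous e.symm) {γ : G} {γ' : G'} (hγ : e γ = γ')
  (hC : IsClosed ((Subgroup.centralizer ({γ} : Set G) : Subgroup G) : Set G))
  (hC' : IsClosed ((Subgroup.centralizer ({γ'} : Set G') : Subgroup G') : Set G'))
  [MeasurableSpace (G ⧸ Subgroup.centralizer ({γ} : Set G))] [BorelSpace (G ⧸ Subgroup.centralizer ({γ} : Set G))]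
  [MeasurableSpace (G' ⧸ Subgroup.centralizer ({γ'} : Set G'))]
  [BorelSpace (G' ⧸ Subgroup.centralizer ({γ'} : Set G'))]
  (ρ : Measure (Subgroup.centralizer ({γ} : Set G))) [ρ.IsMulLeftInvariant] [IsFiniteMeasureOnCompacts ρ]
  [ρ.IsOpenPosMeasure] [ρ.IsInvInvariant] [SFinite ρ]
  (ρ' : Measure (Subgroup.centralizer ({γ'} : Set G'))) [ρ'.IsMulLeftInvariant] [IsFiniteMeasureOnCompacts ρ']
  [ρ'.IsOpenPosMeasure] [ρ'.IsInvInvariant] [SFinite ρ']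
  (ν : Measure G) [IsHaarMeasure ν] [ν.IsMulRightInvariant]
  (ν' : Measure G') [IsHaarMeasure ν'] [ν'.IsMulRightInvariant]

/-- **Orbital integrals against the canonical quotient measures are EQUAL along an isomorphism of topological
groups**: for a bicontinuous `e : G ≃* G'` with `e γ = γ'`, two-sided Haar measures `ν`, `ν' = e_* ν`, and Haar measures
`ρ` on `C(γ)`, `ρ' = (e|_{C(γ)})_* ρ` on `C(γ')`: `O_{γ'}(F; ν'/ρ') = O_γ(F ∘ e; ν/ρ)` for every Banach-valued `F`
(★ `map_cosetCongr_quotientMeasure` is natural, then `orbitalIntegral_map_cosetCongr`).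
[cite: DeitmarEchterhoff2014, Thm. 1.5.3] [cite: Gelbart1975, (9.13)] -/
theorem orbitalIntegral_quotientMeasure_eq_of_mulEquiv
    (hρ' : ρ' = Measure.map (subgroupCongrHomeomorph e _ _
      (forall_apply_mem_centralizer_singleton_iff_of_eq e hγ) he hes) ρ)
    (hν' : ν' = Measure.map e ν) {B : Type*} [NormedAddCommGroup B] [NormedSpace ℝ B] (F : G' → B) :
    orbitalIntegral γ' F (quotientMeasure (Subgroup.centralizer ({γ'} : Set G')) ρ' hC' ν') =
      orbitalIntegral γ (F ∘ e) (quotientMeasure (Subgroup.centralizer ({γ} : Set G)) ρ hC ν) := by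
  rw [← map_cosetCongr_quotientMeasure e he hes (Subgroup.centralizer ({γ} : Set G))
    (Subgroup.centralizer ({γ'} : Set G')) (forall_apply_mem_centralizer_singleton_iff_of_eq e hγ)
    (hH := hC) (hH' := hC') ρ ρ' ν ν' hρ' hν']
  exact orbitalIntegral_map_cosetCongr e he hes hγ _ F

end TransportNormalized

/-! ## §2 The split place: `e = localSplitEquiv : U(J)(F_v) ≃ₜ* GL_N(E_w)` -/

namespace UnitaryGroup

variable {F E : Type} [Field F] [NumberField F] [Field E] [NumberField E] [Algebra F E]
  [Algebra.IsQuadraticExtension F E]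
  (c : E ≃ₐ[F] E) (N : ℕ) (J : Matrix (Fin N) (Fin N) E) {v : HeightOneSpectrum (𝓞 F)}
  (hc : c ≠ 1) (hJ : (J.map c)ᵀ = J) (w : PlacesOver E v) (hw : c • w.1 ≠ w.1)
  (hJw : IsUnit (placeForm J w.1))

/-- **`e(C(γ)) = C(e γ)`** for `e = localSplitEquiv` (the hypothesis of `cosetCongr`). [cite: Mok2014, §1 Notation p. 5] -/
theorem forall_localSplitEquiv_mem_centralizer_iff (γ : «local» E c N J v) :
    ∀ g : «local» E c N J v,
      (localSplitEquiv c J hc hJ w hw hJw).toMulEquiv g ∈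
          Subgroup.centralizer ({localSplitEquiv c J hc hJ w hw hJw γ} : Set (GL (Fin N) (w.1.adicCompletion E))) ↔
        g ∈ Subgroup.centralizer ({γ} : Set («local» E c N J v)) :=
  forall_apply_mem_centralizer_singleton_iff_of_eq (localSplitEquiv c J hc hJ w hw hJw).toMulEquiv rfl

/-- **Recognising `e γ`**: its characteristic polynomial is the `w`-component of that of `γ ∈ GL_N(E ⊗ F_v) = GL_N(∏_{w∣v} E_w)`
(`e` is the `w`-projection, ★ `coe_localSplitEquiv_apply`; for `γ = γ₀ ⊗ 1` rational, `e γ = γ₀` read in `GL_N(E_w)` is ★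
`localSplitEquiv_eq_map_of_eq_toLocalGL`). [cite: Mok2014, §1 Notation p. 5] -/
theorem charpoly_localSplitEquiv (γ : «local» E c N J v) :
    ((localSplitEquiv c J hc hJ w hw hJw γ : GL (Fin N) (w.1.adicCompletion E)) :
        Matrix (Fin N) (Fin N) (w.1.adicCompletion E)).charpoly =
      (((γ : GL (Fin N) (LocalRing E v)) : Matrix (Fin N) (Fin N) (LocalRing E v)).charpoly).map
        (Pi.evalRingHom (fun w' : PlacesOver E v => w'.1.adicCompletion E) w) := by
  rw [← Matrix.charpoly_map]
  rfl

/-- **(d2) Orbital integrals on `U(J)(F_v)` ARE orbital integrals on `GL_N(E_w)` at a split place**: for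
`γ ∈ U(J)(F_v)`, ANY measure `μ` on `U(J)(F_v) ⧸ C(γ)` and any `F` on `GL_N(E_w)`, `Φ^{GL_N(E_w)}(e γ, F; (cosetCongr e)_* μ) =
Φ^{U(J)(F_v)}(γ, F ∘ e; μ)`, `e = localSplitEquiv` the `w`-projection. [cite: Rogawski1990, §4.9 p. 54] [cite: Mok2014, §1 Notation p. 5] -/
theorem orbitalIntegral_localSplitEquiv_map (γ : «local» E c N J v)
    [MeasurableSpace (↥(«local» E c N J v) ⧸ Subgroup.centralizer ({γ} : Set («local» E c N J v)))]
    [BorelSpace (↥(«local» E c N J v) ⧸ Subgroup.centralizer ({γ} : Set («local» E c N J v)))]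
    [MeasurableSpace (GL (Fin N) (w.1.adicCompletion E) ⧸ Subgroup.centralizer ({localSplitEquiv c J hc hJ w hw hJw γ} : Set _))]
    [BorelSpace (GL (Fin N) (w.1.adicCompletion E) ⧸ Subgroup.centralizer ({localSplitEquiv c J hc hJ w hw hJw γ} : Set _))]
    (μ : Measure (↥(«local» E c N J v) ⧸ Subgroup.centralizer ({γ} : Set («local» E c N J v))))
    {B : Type*} [NormedAddCommGroup B] [NormedSpace ℝ B] (F' : GL (Fin N) (w.1.adicCompletion E) → B) :
    orbitalIntegral (localSplitEquiv c J hc hJ w hw hJw γ) F'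
        (μ.map (cosetCongr (localSplitEquiv c J hc hJ w hw hJw).toMulEquiv _ _
          (forall_localSplitEquiv_mem_centralizer_iff c N J hc hJ w hw hJw γ))) =
      orbitalIntegral γ (F' ∘ localSplitEquiv c J hc hJ w hw hJw) μ :=
  orbitalIntegral_map_cosetCongr (localSplitEquiv c J hc hJ w hw hJw).toMulEquiv
    (localSplitEquiv c J hc hJ w hw hJw).continuous (localSplitEquiv c J hc hJ w hw hJw).symm.continuous rfl μ F'

/-- **(d2') Read from the unitary side**: `Φ^{U(J)(F_v)}(γ, f; μ) = Φ^{GL_N(E_w)}(e γ, f ∘ e⁻¹; (cosetCongr e)_* μ)` for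
every measure `μ` on `U(J)(F_v) ⧸ C(γ)` and every `f` on `U(J)(F_v)`. [cite: Rogawski1990, §4.9 p. 54] [cite: Mok2014, §1 Notation p. 5] -/
theorem orbitalIntegral_eq_orbitalIntegral_localSplitEquiv (γ : «local» E c N J v)
    [MeasurableSpace (↥(«local» E c N J v) ⧸ Subgroup.centralizer ({γ} : Set («local» E c N J v)))]
    [BorelSpace (↥(«local» E c N J v) ⧸ Subgroup.centralizer ({γ} : Set («local» E c N J v)))]
    [MeasurableSpace (GL (Fin N) (w.1.adicCompletion E) ⧸ Subgroup.centralizer ({localSplitEquiv c J hc hJ w hw hJw γ} : Set _))]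
    [BorelSpace (GL (Fin N) (w.1.adicCompletion E) ⧸ Subgroup.centralizer ({localSplitEquiv c J hc hJ w hw hJw γ} : Set _))]
    (μ : Measure (↥(«local» E c N J v) ⧸ Subgroup.centralizer ({γ} : Set («local» E c N J v))))
    {B : Type*} [NormedAddCommGroup B] [NormedSpace ℝ B] (f : «local» E c N J v → B) :
    orbitalIntegral γ f μ =
      orbitalIntegral (localSplitEquiv c J hc hJ w hw hJw γ) (f ∘ (localSplitEquiv c J hc hJ w hw hJw).symm)
        (μ.map (cosetCongr (localSplitEquiv c J hc hJ w hw hJw).toMulEquiv _ _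
          (forall_localSplitEquiv_mem_centralizer_iff c N J hc hJ w hw hJw γ))) := by
  rw [orbitalIntegral_localSplitEquiv_map]
  congr 1
  funext g
  simp only [Function.comp_apply, ContinuousMulEquiv.symm_apply_apply]

/-- **(d3) `1_{GL_N(𝒪_w)} ∘ e = 1_{U(J)(𝒪_v)}`** at a split place where `J_w ∈ GL_N(𝒪_w)`: for any `φ` on `GL_N(E_w)`,
`(1_{GL_N(𝒪_w)} · φ) ∘ e = 1_{U(J)(𝒪_v)} · (φ ∘ e)` (★ `mem_localIntegralLevel_iff_of_ne`: `g ∈ U(J)(𝒪_v) ↔ e g ∈ GL_N(𝒪_w)`).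
[cite: PlatonovRapinchuk1994, §5.1] -/
theorem indicator_glInt_comp_localSplitEquiv (hJi : hJw.unit ∈ glInt N (w.1.adicCompletion E)) {M : Type*} [Zero M]
    (φ : GL (Fin N) (w.1.adicCompletion E) → M) :
    (glInt N (w.1.adicCompletion E) : Set (GL (Fin N) (w.1.adicCompletion E))).indicator φ ∘
        (localSplitEquiv c J hc hJ w hw hJw) =
      (localIntegralLevel c N J v : Set («local» E c N J v)).indicator (φ ∘ localSplitEquiv c J hc hJ w hw hJw) :=
  indicator_comp_eq_of_forall_mem_iff _ (fun g => (mem_localIntegralLevel_iff_of_ne c N J hc hJ w hw hJw hJi g).symm) φ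

/-- **(d3) for orbital integrals**: `Φ^{GL_N(E_w)}(e γ, 1_{GL_N(𝒪_w)} φ; (cosetCongr e)_* μ) = Φ^{U(J)(F_v)}(γ, 1_{U(J)(𝒪_v)} (φ ∘ e); μ)`
(at `φ = 1`: `Φ^{GL_N}(e γ, 1_{GL_N(𝒪_w)}) = Φ^{U(J)}(γ, 1_{K_v})`). [cite: Rogawski1990, §4.9 p. 54] [cite: PlatonovRapinchuk1994, §5.1] -/
theorem orbitalIntegral_indicator_glInt_localSplitEquiv_map (hJi : hJw.unit ∈ glInt N (w.1.adicCompletion E))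
    (γ : «local» E c N J v)
    [MeasurableSpace (↥(«local» E c N J v) ⧸ Subgroup.centralizer ({γ} : Set («local» E c N J v)))]
    [BorelSpace (↥(«local» E c N J v) ⧸ Subgroup.centralizer ({γ} : Set («local» E c N J v)))]
    [MeasurableSpace (GL (Fin N) (w.1.adicCompletion E) ⧸ Subgroup.centralizer ({localSplitEquiv c J hc hJ w hw hJw γ} : Set _))]
    [BorelSpace (GL (Fin N) (w.1.adicCompletion E) ⧸ Subgroup.centralizer ({localSplitEquiv c J hc hJ w hw hJw γ} : Set _))]
    (μ : Measure (↥(«local» E c N J v) ⧸ Subgroup.centralizer ({γ} : Set («local» E c N J v))))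
    {B : Type*} [NormedAddCommGroup B] [NormedSpace ℝ B] (φ : GL (Fin N) (w.1.adicCompletion E) → B) :
    orbitalIntegral (localSplitEquiv c J hc hJ w hw hJw γ)
        ((glInt N (w.1.adicCompletion E) : Set (GL (Fin N) (w.1.adicCompletion E))).indicator φ)
        (μ.map (cosetCongr (localSplitEquiv c J hc hJ w hw hJw).toMulEquiv _ _
          (forall_localSplitEquiv_mem_centralizer_iff c N J hc hJ w hw hJw γ))) =
      orbitalIntegral γ ((localIntegralLevel c N J v : Set («local» E c N J v)).indicator
        (φ ∘ localSplitEquiv c J hc hJ w hw hJw)) μ := by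
  rw [orbitalIntegral_localSplitEquiv_map, indicator_glInt_comp_localSplitEquiv c N J hc hJ w hw hJw hJi]

section Haar

variable [MeasurableSpace («local» E c N J v)] [BorelSpace («local» E c N J v)]
  [MeasurableSpace (GL (Fin N) (w.1.adicCompletion E))] [BorelSpace (GL (Fin N) (w.1.adicCompletion E))]

/-- **(d4a) The normalised Haar measures correspond under `e`** at a split place of good reduction (`J_w ∈ GL_N(𝒪_w)`):
if `ν(U(J)(𝒪_v)) = 1` and `ν'(GL_N(𝒪_w)) = 1` then `e` is measure preserving, `e_* ν = ν'` (★ `measurePreserving_of_forall_mem_iff`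
on the level matching ★ `mem_localIntegralLevel_iff_of_ne`; the GL-side instances are binders, ★ `locallyCompactSpace_gl_adicCompletion`
∕ ★ `secondCountableTopology_gl_adicCompletion`). [cite: Rogawski1990, §4.9 p. 54] [cite: PlatonovRapinchuk1994, §5.1] -/
theorem measurePreserving_localSplitEquiv (hJi : hJw.unit ∈ glInt N (w.1.adicCompletion E))
    [LocallyCompactSpace (GL (Fin N) (w.1.adicCompletion E))] [SecondCountableTopology (GL (Fin N) (w.1.adicCompletion E))]
    (ν : Measure («local» E c N J v)) [IsHaarMeasure ν] (ν' : Measure (GL (Fin N) (w.1.adicCompletion E)))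
    [IsHaarMeasure ν'] (hν : ν (localIntegralLevel c N J v) = 1) (hν' : ν' (glInt N (w.1.adicCompletion E)) = 1) :
    MeasurePreserving (localSplitEquiv c J hc hJ w hw hJw) ν ν' :=
  measurePreserving_of_forall_mem_iff (localSplitEquiv c J hc hJ w hw hJw)
    (K := (localIntegralLevel c N J v : Set («local» E c N J v)))
    (K' := (glInt N (w.1.adicCompletion E) : Set (GL (Fin N) (w.1.adicCompletion E))))
    (fun g => (mem_localIntegralLevel_iff_of_ne c N J hc hJ w hw hJw hJi g).symm) ν ν' hν hν'

/-- **(d4a) `e_* ν = ν'`** for the normalised Haar measures (`vol U(J)(𝒪_v) = 1 ↦ vol GL_N(𝒪_w) = 1`).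
[cite: Rogawski1990, §4.9 p. 54] [cite: PlatonovRapinchuk1994, §5.1] -/
theorem map_localSplitEquiv_eq (hJi : hJw.unit ∈ glInt N (w.1.adicCompletion E))
    [LocallyCompactSpace (GL (Fin N) (w.1.adicCompletion E))] [SecondCountableTopology (GL (Fin N) (w.1.adicCompletion E))]
    (ν : Measure («local» E c N J v)) [IsHaarMeasure ν] (ν' : Measure (GL (Fin N) (w.1.adicCompletion E)))
    [IsHaarMeasure ν'] (hν : ν (localIntegralLevel c N J v) = 1) (hν' : ν' (glInt N (w.1.adicCompletion E)) = 1) :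
    ν.map (localSplitEquiv c J hc hJ w hw hJw) = ν' :=
  (measurePreserving_localSplitEquiv c N J hc hJ w hw hJw hJi ν ν' hν hν').map_eq

/-- **(d4b) On the centralisers** `e| : C(γ) ≃ₜ C(e γ)` (★ `subgroupCongrHomeomorph`): `(e|)_* ρ` gives
`{t' ∈ C(e γ) | t' ∈ GL_N(𝒪_w)}` the `ρ`-mass of `{t ∈ C(γ) | t ∈ U(J)(𝒪_v)}` — the normalisation «`vol (C(γ) ∩ K_v) = 1`»
(measures on the tori with `T(𝒪_v)` of mass one for almost all `v`) transports to «`vol (C(e γ) ∩ GL_N(𝒪_w)) = 1`».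
[cite: Rogawski1990, §4.3 p. 44] [cite: PlatonovRapinchuk1994, §5.1] -/
theorem map_subgroupCongrHomeomorph_localSplitEquiv_apply (hJi : hJw.unit ∈ glInt N (w.1.adicCompletion E))
    (γ : «local» E c N J v) (ρ : Measure (Subgroup.centralizer ({γ} : Set («local» E c N J v)))) :
    (ρ.map (subgroupCongrHomeomorph (localSplitEquiv c J hc hJ w hw hJw).toMulEquiv _ _
        (forall_localSplitEquiv_mem_centralizer_iff c N J hc hJ w hw hJw γ)
        (localSplitEquiv c J hc hJ w hw hJw).continuous (localSplitEquiv c J hc hJ w hw hJw).symm.continuous))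
        {t' | (t' : GL (Fin N) (w.1.adicCompletion E)) ∈ glInt N (w.1.adicCompletion E)} =
      ρ {t | (t : «local» E c N J v) ∈ localIntegralLevel c N J v} := by
  rw [← Homeomorph.toMeasurableEquiv_coe, MeasurableEquiv.map_apply]
  congr 1
  ext t
  simp only [mem_preimage, mem_setOf_eq, Homeomorph.toMeasurableEquiv_coe, coe_subgroupCongrHomeomorph_apply]
  exact (mem_localIntegralLevel_iff_of_ne c N J hc hJ w hw hJw hJi (t : «local» E c N J v)).symm

variable [LocallyCompactSpace (GL (Fin N) (w.1.adicCompletion E))]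
  [SecondCountableTopology (GL (Fin N) (w.1.adicCompletion E))]
  (γ : «local» E c N J v)
  (hC : IsClosed ((Subgroup.centralizer ({γ} : Set («local» E c N J v)) : Subgroup («local» E c N J v)) : Set («local» E c N J v)))
  (hC' : IsClosed ((Subgroup.centralizer ({localSplitEquiv c J hc hJ w hw hJw γ} : Set (GL (Fin N) (w.1.adicCompletion E))) :
    Subgroup (GL (Fin N) (w.1.adicCompletion E))) : Set (GL (Fin N) (w.1.adicCompletion E))))
  [MeasurableSpace (↥(«local» E c N J v) ⧸ Subgroup.centralizer ({γ} : Set («local» E c N J v)))]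
  [BorelSpace (↥(«local» E c N J v) ⧸ Subgroup.centralizer ({γ} : Set («local» E c N J v)))]
  [MeasurableSpace (GL (Fin N) (w.1.adicCompletion E) ⧸ Subgroup.centralizer ({localSplitEquiv c J hc hJ w hw hJw γ} : Set _))]
  [BorelSpace (GL (Fin N) (w.1.adicCompletion E) ⧸ Subgroup.centralizer ({localSplitEquiv c J hc hJ w hw hJw γ} : Set _))]
  (ρ : Measure (Subgroup.centralizer ({γ} : Set («local» E c N J v)))) [ρ.IsMulLeftInvariant]
  [IsFiniteMeasureOnCompacts ρ] [ρ.IsOpenPosMeasure] [ρ.IsInvInvariant] [SFinite ρ]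
  (ρ' : Measure (Subgroup.centralizer ({localSplitEquiv c J hc hJ w hw hJw γ} : Set (GL (Fin N) (w.1.adicCompletion E)))))
  [ρ'.IsMulLeftInvariant] [IsFiniteMeasureOnCompacts ρ'] [ρ'.IsOpenPosMeasure] [ρ'.IsInvInvariant] [SFinite ρ']
  (ν : Measure («local» E c N J v)) [IsHaarMeasure ν] [ν.IsMulRightInvariant]
  (ν' : Measure (GL (Fin N) (w.1.adicCompletion E))) [IsHaarMeasure ν'] [ν'.IsMulRightInvariant]

/-- **(d4) The canonical quotient measures correspond**: with `ρ' = (e|_{C(γ)})_* ρ` on `C(e γ)` and the normalised Haar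
measures `ν(U(J)(𝒪_v)) = 1`, `ν'(GL_N(𝒪_w)) = 1`: `(cosetCongr e)_* (ν/ρ) = ν'/ρ'` on `GL_N(E_w) ⧸ C(e γ)`
(★ `map_cosetCongr_quotientMeasure` + (d4a)). [cite: DeitmarEchterhoff2014, Thm. 1.5.3] [cite: Rogawski1990, §4.9 p. 54] -/
theorem map_cosetCongr_localSplitEquiv_quotientMeasure (hJi : hJw.unit ∈ glInt N (w.1.adicCompletion E))
    (hρ' : ρ' = Measure.map (subgroupCongrHomeomorph (localSplitEquiv c J hc hJ w hw hJw).toMulEquiv _ _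
      (forall_localSplitEquiv_mem_centralizer_iff c N J hc hJ w hw hJw γ)
      (localSplitEquiv c J hc hJ w hw hJw).continuous (localSplitEquiv c J hc hJ w hw hJw).symm.continuous) ρ)
    (hν : ν (localIntegralLevel c N J v) = 1) (hν' : ν' (glInt N (w.1.adicCompletion E)) = 1) :
    (quotientMeasure (Subgroup.centralizer ({γ} : Set («local» E c N J v))) ρ hC ν).map
        (cosetCongr (localSplitEquiv c J hc hJ w hw hJw).toMulEquiv _ _
          (forall_localSplitEquiv_mem_centralizer_iff c N J hc hJ w hw hJw γ)) =
      quotientMeasure (Subgroup.centralizer ({localSplitEquiv c J hc hJ w hw hJw γ} :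
        Set (GL (Fin N) (w.1.adicCompletion E)))) ρ' hC' ν' := by
  exact map_cosetCongr_quotientMeasure (localSplitEquiv c J hc hJ w hw hJw).toMulEquiv
    (localSplitEquiv c J hc hJ w hw hJw).continuous (localSplitEquiv c J hc hJ w hw hJw).symm.continuous _ _
    (forall_localSplitEquiv_mem_centralizer_iff c N J hc hJ w hw hJw γ) (hH := hC) (hH' := hC') ρ ρ' ν ν' hρ'
    (map_localSplitEquiv_eq c N J hc hJ w hw hJw hJi ν ν' hν hν').symm

/-- **(d4) Orbital integrals against the canonical quotient measures are EQUAL across the split-place dictionary**: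
`Φ^{GL_N(E_w)}_{ν'/ρ'}(e γ, F) = Φ^{U(J)(F_v)}_{ν/ρ}(γ, F ∘ e)` for every Banach-valued `F` (`ρ' = (e|)_* ρ`,
`vol U(J)(𝒪_v) = vol GL_N(𝒪_w) = 1`). [cite: Rogawski1990, §4.9 p. 54] [cite: DeitmarEchterhoff2014, Thm. 1.5.3] -/
theorem orbitalIntegral_localSplitEquiv_quotientMeasure (hJi : hJw.unit ∈ glInt N (w.1.adicCompletion E))
    (hρ' : ρ' = Measure.map (subgroupCongrHomeomorph (localSplitEquiv c J hc hJ w hw hJw).toMulEquiv _ _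
      (forall_localSplitEquiv_mem_centralizer_iff c N J hc hJ w hw hJw γ)
      (localSplitEquiv c J hc hJ w hw hJw).continuous (localSplitEquiv c J hc hJ w hw hJw).symm.continuous) ρ)
    (hν : ν (localIntegralLevel c N J v) = 1) (hν' : ν' (glInt N (w.1.adicCompletion E)) = 1)
    {B : Type*} [NormedAddCommGroup B] [NormedSpace ℝ B] (F' : GL (Fin N) (w.1.adicCompletion E) → B) :
    orbitalIntegral (localSplitEquiv c J hc hJ w hw hJw γ) F'
        (quotientMeasure (Subgroup.centralizer ({localSplitEquiv c J hc hJ w hw hJw γ} :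
          Set (GL (Fin N) (w.1.adicCompletion E)))) ρ' hC' ν') =
      orbitalIntegral γ (F' ∘ localSplitEquiv c J hc hJ w hw hJw)
        (quotientMeasure (Subgroup.centralizer ({γ} : Set («local» E c N J v))) ρ hC ν) :=
  orbitalIntegral_quotientMeasure_eq_of_mulEquiv (localSplitEquiv c J hc hJ w hw hJw).toMulEquiv
    (localSplitEquiv c J hc hJ w hw hJw).continuous (localSplitEquiv c J hc hJ w hw hJw).symm.continuous rfl hC hC'
    ρ ρ' ν ν' hρ' (map_localSplitEquiv_eq c N J hc hJ w hw hJw hJi ν ν' hν hν').symm F'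

/-- **(d4) The unramified constants agree**: `Φ^{GL_N(E_w)}_{ν'/ρ'}(e γ, 1_{GL_N(𝒪_w)} φ) = Φ^{U(J)(F_v)}_{ν/ρ}(γ, 1_{U(J)(𝒪_v)} (φ ∘ e))`
for the canonical measures; at `φ = 1`: `Φ^{GL_N}(e γ, 1_{GL_N(𝒪_w)}) = Φ^{U(J)}(γ, 1_{K_v})` — the normalising orbital integrals at a
split unramified place may be computed in `GL_N(E_w)`. [cite: Rogawski1990, §4.9 p. 54] [cite: PlatonovRapinchuk1994, §5.1] -/
theorem orbitalIntegral_indicator_glInt_localSplitEquiv_quotientMeasure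
    (hJi : hJw.unit ∈ glInt N (w.1.adicCompletion E))
    (hρ' : ρ' = Measure.map (subgroupCongrHomeomorph (localSplitEquiv c J hc hJ w hw hJw).toMulEquiv _ _
      (forall_localSplitEquiv_mem_centralizer_iff c N J hc hJ w hw hJw γ)
      (localSplitEquiv c J hc hJ w hw hJw).continuous (localSplitEquiv c J hc hJ w hw hJw).symm.continuous) ρ)
    (hν : ν (localIntegralLevel c N J v) = 1) (hν' : ν' (glInt N (w.1.adicCompletion E)) = 1)
    {B : Type*} [NormedAddCommGroup B] [NormedSpace ℝ B] (φ : GL (Fin N) (w.1.adicCompletion E) → B) :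
    orbitalIntegral (localSplitEquiv c J hc hJ w hw hJw γ)
        ((glInt N (w.1.adicCompletion E) : Set (GL (Fin N) (w.1.adicCompletion E))).indicator φ)
        (quotientMeasure (Subgroup.centralizer ({localSplitEquiv c J hc hJ w hw hJw γ} :
          Set (GL (Fin N) (w.1.adicCompletion E)))) ρ' hC' ν') =
      orbitalIntegral γ ((localIntegralLevel c N J v : Set («local» E c N J v)).indicator
          (φ ∘ localSplitEquiv c J hc hJ w hw hJw))
        (quotientMeasure (Subgroup.centralizer ({γ} : Set («local» E c N J v))) ρ hC ν) := by
  rw [orbitalIntegral_localSplitEquiv_quotientMeasure c N J hc hJ w hw hJw γ hC hC' ρ ρ' ν ν' hJi hρ' hν hν',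
    indicator_glInt_comp_localSplitEquiv c N J hc hJ w hw hJw hJi]

end Haar

end UnitaryGroup

end Literature.NumberTheory.Automorphic

end
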